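import Mathlib
import Summits.Parity.GeneralizedHardyLittlewood.Theorems.FordMaynardSieveConst01651SieveConst01651HwtSplit

/-!
# Route `FordMaynardSieveConst01651`, target `SieveConst01651` (stmt-Parity-19185), line `sieve_decomposition`:
# helpers towards `stub_typeIIRegion` — `H(n)` in the MAIN CASE `n₁ > 1`: only the cutoff survives

Ford–Maynard, arXiv:2407.14368v1, proof of Proposition 7.22 (p. 40) / Lemma 7.18 (a): with
`H(n) = ∑_{m ∣ n₂} g(𝐯(m; n)) ∑_{u ∣ n₁, um ≤ n^{1/2}} μ(u)` (tree: `…HwtSplit.Hwt_eq_sum_rough_mul_sum_moebius`)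
and `∑_{u ∣ n₁} μ(u) = 0` for `n₁ > 1`, only the complementary cutoff `u m > n^{1/2}` survives, with a sign; the
term `u = 1` then vanishes by the CLOSED support of `g` (`m > n^{1/2}` forces `|𝐯(m; n)| > 1/2`), and `μ(u) = 0`
unless `u` is squarefree.  Hence, for the support clause of `…Defs.Admissible`:

* `sum_pvec'` — `∑ᵢ 𝐯(d; n)ᵢ = log d / log n` (adapted from the skeleton `Lines/sieve_decomposition.lean`);
* `apply_pvec_eq_zero_of_sqrt_lt'` — `g(𝐯(d; n)) = 0` for `d > n^{1/2}` (adapted from the skeleton);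
* `sum_divisors_moebius_cutoff_eq_neg` — `∑_{u ∣ N} 𝟙[c(u)] μ(u) = -∑_{u ∣ N} 𝟙[¬ c(u)] μ(u)` for `N > 1`;
* `Hwt_eq_neg_sum_main` — for `n ≥ 2` with `smoothPart n^ν n > 1`:
  `H(n) = -∑_{m ∣ n₂} ∑_{u ∣ n₁, u ≥ 2, u squarefree} 𝟙[u m > n^{1/2}] μ(u) g(𝐯(m; n))`.

Def-free. Nothing here proves anything about the Parity summit; helpers for the Type-II region stub of one leaf.
-/

open Finset Literature.NumberTheory.Sieve Literature.NumberTheory.Sieve.FordMaynard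

namespace Summit.Parity.GeneralizedHardyLittlewood.FordMaynardSieveConst01651SieveConst01651

/-- `∑ log pᵢ = log ∏ pᵢ` over a list of positive naturals. [folklore] -/
theorem sum_map_log_eq_log_prod : ∀ (l : List ℕ), (∀ p ∈ l, 0 < p) →
    (l.map (fun p : ℕ => Real.log p)).sum = Real.log ((l.prod : ℕ) : ℝ)
  | [], _ => by simp
  | (p :: l), h => by
      have hp : 0 < p := h p (by simp)
      have hl : ∀ q ∈ l, 0 < q := fun q hq => h q (by simp [hq])
      have hprod : 0 < l.prod := List.prod_pos hl
      rw [List.map_cons, List.sum_cons, List.prod_cons, Nat.cast_mul,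
        Real.log_mul (by exact_mod_cast hp.ne') (by exact_mod_cast hprod.ne'), sum_map_log_eq_log_prod l hl]

/-- **`|𝐯(d; n)| = log d / log n`** (the components of `𝐯(d; n)` are `log p / log n` over the prime factors of `d`
with multiplicity). -- adapted from Cruxes/SieveConst01651/Lines/sieve_decomposition.lean (`sum_pvec`)
[cite: FordMaynard2024PrimeSieves, §7.2 (the vectors 𝐯(d; n))] -/
theorem sum_pvec' {n d : ℕ} (hd : d ≠ 0) : ∑ i, pvec n d i = Real.log d / Real.log n := by
  unfold pvec
  rw [← Finset.sum_div]
  congr 1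
  have h1 : ∑ i : Fin d.primeFactorsList.length, Real.log ((d.primeFactorsList.get i : ℕ) : ℝ)
      = (d.primeFactorsList.map (fun p : ℕ => Real.log p)).sum := by
    simp only [List.get_eq_getElem]
    exact Fin.sum_univ_fun_getElem d.primeFactorsList (fun p : ℕ => Real.log p)
  rw [h1, sum_map_log_eq_log_prod _ (fun p hp => Nat.pos_of_mem_primeFactorsList hp),
    Nat.prod_primeFactorsList hd]

/-- **The closed support kills divisors beyond `n^{1/2}`**: if `g` has the support clause of `Admissible ν g`
(`g_k(x) ≠ 0 ⇒ k = 0 ∨ (xᵢ > ν ∧ ∑ xᵢ ≤ 1/2)`), then `g(𝐯(d; n)) = 0` for every `d > n^{1/2}`, `n ≥ 2`.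
-- adapted from Cruxes/SieveConst01651/Lines/sieve_decomposition.lean (`apply_pvec_eq_zero_of_sqrt_lt`)
[cite: FordMaynard2024PrimeSieves, Lemma 7.18 (a) (divisors `d > n^γ`)] -/
theorem apply_pvec_eq_zero_of_sqrt_lt' {ν : ℝ} {g : VecFn}
    (hsupp : ∀ (k : ℕ) (x : Fin k → ℝ), g k x ≠ 0 → k = 0 ∨ ((∀ i, ν < x i) ∧ ∑ i, x i ≤ 1 / 2))
    {n d : ℕ} (hn : 2 ≤ n) (hd0 : d ≠ 0) (hlt : (n : ℝ) ^ (1 / 2 : ℝ) < d) :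
    g d.primeFactorsList.length (pvec n d) = 0 := by
  by_contra hne
  rcases hsupp _ _ hne with h0 | ⟨-, hsum⟩
  · have hnil : d.primeFactorsList = [] := List.eq_nil_of_length_eq_zero h0
    rcases (Nat.primeFactorsList_eq_nil d).1 hnil with h | h
    · exact hd0 h
    · subst h
      simp only [Nat.cast_one] at hlt
      have h1n : (1 : ℝ) ≤ (n : ℝ) ^ (1 / 2 : ℝ) :=
        Real.one_le_rpow (by exact_mod_cast (by omega : 1 ≤ n)) (by norm_num)
      linarith
  · rw [sum_pvec' hd0] at hsum
    have hlogn : 0 < Real.log n := Real.log_pos (by exact_mod_cast (by omega : 1 < n))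
    have h1 : Real.log d ≤ (1 / 2 : ℝ) * Real.log n := by rwa [div_le_iff₀ hlogn] at hsum
    have hnpos : (0 : ℝ) < n := by exact_mod_cast (by omega : 0 < n)
    have h2 := Real.log_lt_log (Real.rpow_pos_of_pos hnpos _) hlt
    rw [Real.log_rpow hnpos] at h2
    linarith

/-- **`∑_{u ∣ N} μ(u) = 0` lets a cutoff be replaced by its complement, with a sign** (`N > 1`):
`∑_{u ∣ N} 𝟙[c u] μ(u) = -∑_{u ∣ N} 𝟙[¬ c u] μ(u)`. [cite: FordMaynard2024PrimeSieves, proof of Proposition 7.22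
("since `n₁ > 1` … `∑_{u ∣ n₁} λ(u) = 0`")] -/
theorem sum_divisors_moebius_cutoff_eq_neg {N : ℕ} (hN : 1 < N) (c : ℕ → Prop) [DecidablePred c] :
    ∑ u ∈ N.divisors, (if c u then ((ArithmeticFunction.moebius u : ℤ) : ℝ) else 0) =
      -∑ u ∈ N.divisors, (if c u then 0 else ((ArithmeticFunction.moebius u : ℤ) : ℝ)) := by
  have hμ : ∑ u ∈ N.divisors, ((ArithmeticFunction.moebius u : ℤ) : ℝ) = 0 := by
    have h := congr_arg (fun f : ArithmeticFunction ℤ => f N) ArithmeticFunction.moebius_mul_coe_zeta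
    simp only [ArithmeticFunction.coe_mul_zeta_apply, ArithmeticFunction.one_apply, if_neg hN.ne'] at h
    exact_mod_cast h
  have hsplit : ∑ u ∈ N.divisors, ((ArithmeticFunction.moebius u : ℤ) : ℝ) =
      ∑ u ∈ N.divisors, (if c u then ((ArithmeticFunction.moebius u : ℤ) : ℝ) else 0) +
        ∑ u ∈ N.divisors, (if c u then 0 else ((ArithmeticFunction.moebius u : ℤ) : ℝ)) := by
    rw [← Finset.sum_add_distrib]
    exact Finset.sum_congr rfl fun u _ => by split_ifs <;> simp
  linarith

/-- **`H(n)` in the main case.** Let `g` satisfy the support clause of `Admissible ν g`, `n ≥ 2`, and suppose the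
`n^ν`-smooth part `n₁ = smoothPart n^ν n` exceeds `1` (Ford–Maynard's "`n₁ > 1`").  Then
`H(n) = -∑_{m ∣ n₂} ∑_{u ∣ n₁, u ≥ 2, u squarefree} 𝟙[u m > n^{1/2}] μ(u) g(𝐯(m; n))`:
the full Möbius sum over `u ∣ n₁` vanishes, the term `u = 1` of the complementary cutoff vanishes by the closed
support (`m > n^{1/2}`), and non-squarefree `u` have `μ(u) = 0`.
[cite: FordMaynard2024PrimeSieves, proof of Proposition 7.22 (first display, case `n₁ > 1`)] -/
theorem Hwt_eq_neg_sum_main {ν : ℝ} {g : VecFn}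
    (hsupp : ∀ (k : ℕ) (x : Fin k → ℝ), g k x ≠ 0 → k = 0 ∨ ((∀ i, ν < x i) ∧ ∑ i, x i ≤ 1 / 2))
    {n : ℕ} (hn : 2 ≤ n) (h1 : 1 < smoothPart ((n : ℝ) ^ ν) n) :
    Hwt g ν n = -∑ m ∈ (roughPart ((n : ℝ) ^ ν) n).divisors,
      ∑ u ∈ ((smoothPart ((n : ℝ) ^ ν) n).divisors).filter (fun u : ℕ => 2 ≤ u ∧ Squarefree u),
        if ((u * m : ℕ) : ℝ) ≤ (n : ℝ) ^ (1 / 2 : ℝ) then 0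
        else ((ArithmeticFunction.moebius u : ℤ) : ℝ) * g _ (pvec n m) := by
  classical
  have hn0 : n ≠ 0 := by omega
  rw [Hwt_eq_sum_rough_mul_sum_moebius g ν hn0, ← Finset.sum_neg_distrib]
  refine Finset.sum_congr rfl fun m hm => ?_
  have hm0 : m ≠ 0 := (Nat.pos_of_mem_divisors hm).ne'
  rw [sum_divisors_moebius_cutoff_eq_neg h1, mul_neg, Finset.mul_sum, Finset.sum_filter]
  congr 1
  refine Finset.sum_congr rfl fun u hu => ?_
  have hu0 : u ≠ 0 := (Nat.pos_of_mem_divisors hu).ne'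
  by_cases hcut : ((u * m : ℕ) : ℝ) ≤ (n : ℝ) ^ (1 / 2 : ℝ)
  · simp only [if_pos hcut, mul_zero, ite_self]
  · rw [if_neg hcut]
    by_cases hcond : 2 ≤ u ∧ Squarefree u
    · rw [if_pos hcond, if_neg hcut]; ring
    · rw [if_neg hcond]
      -- either `u = 1` (closed support kills the term) or `u` is not squarefree (`μ u = 0`)
      by_cases hu1 : u = 1
      · subst hu1
        have hlt : (n : ℝ) ^ (1 / 2 : ℝ) < m := by
          rw [not_le] at hcut; simpa using hcut
        rw [apply_pvec_eq_zero_of_sqrt_lt' hsupp hn hm0 hlt]; ring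
      · have hsq : ¬ Squarefree u := fun hsq => hcond ⟨by omega, hsq⟩
        rw [ArithmeticFunction.moebius_eq_zero_of_not_squarefree hsq]; simp

end Summit.Parity.GeneralizedHardyLittlewood.FordMaynardSieveConst01651SieveConst01651
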